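import Mathlib
import HarnessLib
import Summits.HubbardSuperconductivity.HubbardSuperconductivity.Theorems.KLProgrammeKLRegimeTwoLegKernelMomentsDefs
import Summits.HubbardSuperconductivity.HubbardSuperconductivity.Theorems.KLProgrammeKLRegimeSplitTwoLegMomentsFromPosition
import Summits.HubbardSuperconductivity.HubbardSuperconductivity.Theorems.KLProgrammeKLRegimeSplitTwoLegCounterVertex
import Summits.HubbardSuperconductivity.HubbardSuperconductivity.Theorems.KLProgrammeKLRegimeSplitSymInterpBounds
import Summits.HubbardSuperconductivity.HubbardSuperconductivity.Theorems.KLProgrammeKLRegimeVolumeLimitNestedPoisson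
import Summits.HubbardSuperconductivity.HubbardSuperconductivity.Theorems.KLProgrammeKLRegimeVolumeLimitCauchyTermwise

/-!
# Route `KLProgramme` — crux K3: **the corollary `CarrierModulusOfTwoLegMoments Pr W` HOLDS** — the engine-private invariant (E3-M)
# `TwoLegKernelMoments` along the tower gives the one-volume MOMENTUM MODULUS (M) of the VL child's framed carrier export
# (cell gate-hubbard-kl, seat hubbard-kl-k3c5-p1 g6 «stub_asm_matsubara suppliers»; plan g14 (R15)(ii) CORRECTED + TASK 2026-08-27T06:12:26Z;
# companion of `…KLRegimeTwoLegKernelMomentsDefs` (p506410); `--supports` the ENGINE child as a helper — the VL child's (M) half reads it)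

The statement `CarrierModulusOfTwoLegMoments Pr W := TwoLegMomentsText Pr W → FramedCarrierModulusText Pr W` was TYPED in the Defs file; here it is
PROVED, for every bundle `Pr : Preds` and window `W : Set ℝ` (nothing of the prefix is read), with the explicit constants
`D := 2·twoLegMomentBar P Q U (nScales β + 1) + 2·coeffNorm 1 K`, `ρ′ := 0`, and the thresholds of the moments text.

Mechanism (model-free given the tree's two-leg Fourier kit; every Matsubara label `ω`):
* `norm_selfEnergy_sep_sub_le` — **per volume**: if the unsectorised two-leg position kernel `W_σ` of the counterterm-separated action
  `G'_n(K) = klSepAction … n` has pinned first SITE moment `ε_x Σ_y |x⃗ − y⃗|_{ℓ^∞,𝕋} ‖W_σ(x,y)‖ ≤ B` for every pinned `x`, then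
  `‖Σ_{G'}((ω,k₁),σ) − Σ_{G'}((ω,k₂),σ)‖ ≤ 2B · Σ_i |p_{k₁} i − p_{k₂} i|_𝕋` — Fourier inversion of the two-leg coefficient
  (p1b's `card_sq_mul_kernel_two_eq_sum` + `conj_phase_eq_cexp_mul_torusChar`: `|Λ|² F₂((ω,k)) = Σ_x W(x) e^{iωΔt} χ_k(x⃗₀ − x⃗₁)`, `Σ = 2βL² F₂`,
  `ε_x|Λ| = βL²`), the character-difference bound `‖χ_{k₁}(z⃗) − χ_{k₂}(z⃗)‖ ≤ |z⃗|_{ℓ^∞,𝕋} · Σ_i |p_{k₁} i − p_{k₂} i|_𝕋`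
  (k3c5-p3's `norm_torusChar_sub_torusChar_le`, centred representatives below the periodic `ℓ^∞` norm), and `Σ_{x : Fin 2 → Λ} = Σ_{x₀} Σ_{x₁}`;
* `TwoLegKernelMoments.norm_selfEnergy_sep_sub_le` — hence from (E3-M) at scale `n` with `B := twoLegMomentBar P Q U n`;
* `abs_eval_latticeMomentum_sub_le` — the frame summand `Σ_{𝒩_K}((ω,k⃗),σ) = K(p_k⃗)` (`selfEnergy_counterQuadratic`) is Lipschitz modulo `2π`:
  `|K(p_{k₁}) − K(p_{k₂})| ≤ 2·coeffNorm 1 K · Σ_i |p_{k₁} i − p_{k₂} i|_𝕋` (`abs_eval_sub_eval_le` + `eval_periodic` + k3c4-p1's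
  `norm_sub_le_mul_tmod_of_periodic`);
* **`carrierModulusOfTwoLegMoments_holds (Pr W) : CarrierModulusOfTwoLegMoments Pr W`** — the assembly (`klSelfEnergy = Σ_{G'} + K∘p`,
  `klSelfEnergy_eq_sep_add_counter`).

Everything is PROVED; no definitions; nothing about the model is asserted; nothing asserts superconductivity.
References: BGM 2006 §2.1 (2.5), §2.3 (2.17) [cite: BenfattoGiulianiMastropietro2006].
-/

noncomputable section

namespace Summit.HubbardSuperconductivity.HubbardSuperconductivity.Theorems.KLRegimeSplit

set_option linter.dupNamespace false -- summit = problem name (single-conjunct summit), D-0017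

open Real Finset Filter Topology Literature.MathematicalPhysics.QuantumLattice Literature.Probability.LatticeModels GrassmannAlgebra
open Summit.HubbardSuperconductivity.HubbardSuperconductivity.Theorems.KLProgrammeLegKernels
open Summit.HubbardSuperconductivity.HubbardSuperconductivity.Theorems.TwoLegFourier
open Summit.HubbardSuperconductivity.HubbardSuperconductivity.Theorems.TwoPointAssembly

section PerVolume

variable {L M : ℕ} [NeZero L]

/-- The centred representative of a coordinate of `z` is at most the periodic `ℓ^∞` norm of `z` (`= torusSiteDist a b` for `z = a - b`). -/
theorem abs_cRepZ_le_torusSiteDist (a b : TorusSite 2 L) (i : Fin 2) :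
    |(Torus.cRepZ ((a - b) i) : ℝ)| ≤ torusSiteDist a b := by
  rw [torusSiteDist, torusDist]
  have hnat : (Torus.cRepZ ((a - b) i)).natAbs = min ((a - b) i).val (L - ((a - b) i).val) := by
    have hv : ((a - b) i).val < L := ZMod.val_lt _
    unfold Torus.cRepZ
    split_ifs with h <;> omega
  have hle : min ((a - b) i).val (L - ((a - b) i).val) ≤ torusNorm (a - b) := by
    unfold torusNorm
    exact Finset.le_sup (f := fun j => min ((a - b) j).val (L - ((a - b) j).val)) (Finset.mem_univ i)
  have habs : |(Torus.cRepZ ((a - b) i) : ℝ)| = ((Torus.cRepZ ((a - b) i)).natAbs : ℝ) := by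
    rw [← Int.cast_natCast, Int.natCast_natAbs, Int.cast_abs]
  rw [habs]
  rw [hnat]
  exact_mod_cast hle

/-- **Characters are Lipschitz in the momentum at rate the periodic `ℓ^∞` distance**:
`‖χ_{k₁}(a − b) − χ_{k₂}(a − b)‖ ≤ |a − b|_{ℓ^∞,𝕋} · Σ_i |p_{k₁} i − p_{k₂} i|_𝕋`. -/
theorem norm_torusChar_sub_torusChar_le_torusSiteDist (k₁ k₂ a b : TorusSite 2 L) :
    ‖torusChar k₁ (a - b) - torusChar k₂ (a - b)‖ ≤
      torusSiteDist a b * ∑ i, torusAbs (latticeMomentum L k₁ i - latticeMomentum L k₂ i) := by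
  refine (norm_torusChar_sub_torusChar_le k₁ k₂ (a - b)).trans ?_
  rw [Finset.mul_sum]
  refine Finset.sum_le_sum fun i _ => mul_le_mul_of_nonneg_right (abs_cRepZ_le_torusSiteDist a b i) (klvc_torusAbs_nonneg _)

/-- Sums over two-point tuples are double sums: `Σ_{x : Fin 2 → α} f (x 0) (x 1) = Σ_a Σ_b f a b`. -/
theorem sum_fin_two_tuple {α : Type*} [Fintype α] (f : α → α → ℝ) :
    ∑ x : Fin 2 → α, f (x 0) (x 1) = ∑ a, ∑ b, f a b := by
  rw [← (piFinTwoEquiv fun _ => α).symm.sum_comp, Fintype.sum_prod_type]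
  simp only [piFinTwoEquiv_symm_apply, Fin.cons_zero, Fin.cons_one]

/-- **THE MOMENTUM MODULUS OF THE SEPARATED SELF-ENERGY FROM THE FIRST SITE MOMENT** (per volume, every Matsubara label).
If the unsectorised two-leg position kernel of `G'_n(K)` at spin `σ` has pinned first site moment `ε_x Σ_y |x⃗ − y⃗|_𝕋 ‖W(x,y)‖ ≤ B` for every
pinned point `x`, then `‖Σ_{G'}((ω,k₁),σ) − Σ_{G'}((ω,k₂),σ)‖ ≤ 2B · Σ_i |p_{k₁} i − p_{k₂} i|_𝕋` for every label `ω`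
(Fourier inversion `βL²·F₂ = |Λ|⁻¹ Σ_x W e^{iωΔt} χ_k(Δx⃗)`, `Σ = 2βL² F₂`, `ε_x|Λ| = βL²`). -/
theorem norm_selfEnergy_sep_sub_le [NeZero M] {β : ℝ} (hβ : 0 < β) (U μ : ℝ) (K : TrigPolyC4v) (e₀ : ℝ) (n : ℕ)
    (σ : Fin 2) (ω : MatsubaraIdx M) (k₁ k₂ : TorusSite 2 L) {B : ℝ}
    (hB : ∀ x : SpaceTimeIdx L M,
      imagTimeWeight β M * ∑ y : SpaceTimeIdx L M, torusSiteDist x.2 y.2 * ‖klTwoLegPosKernel L M β U μ K e₀ n σ x y‖ ≤ B) :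
    ‖selfEnergy L M β (klSepAction L M β U μ K e₀ n) (ω, k₁) σ - selfEnergy L M β (klSepAction L M β U μ K e₀ n) (ω, k₂) σ‖ ≤
      2 * B * ∑ i, torusAbs (latticeMomentum L k₁ i - latticeMomentum L k₂ i) := by
  set G' := klSepAction L M β U μ K e₀ n with hG'
  set W := sectorisedKernel L M β (trivialMultiplier L M) G' 2 (![((0, σ), 0), ((0, σ), 1)] : Fin 2 → SectorLeg 1) with hW
  set T : ℝ := ∑ i, torusAbs (latticeMomentum L k₁ i - latticeMomentum L k₂ i) with hT
  set P : ℝ := (Fintype.card (SpaceTimeIdx L M) : ℝ) with hP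
  set ε : ℝ := imagTimeWeight β M with hε
  have hT0 : 0 ≤ T := sum_nonneg fun i _ => klvc_torusAbs_nonneg _
  have hPpos : 0 < P := by
    rw [hP]; exact_mod_cast (Fintype.card_pos_iff.2 ⟨(ω, k₁)⟩ : 0 < Fintype.card (SpaceTimeIdx L M))
  have hεpos : 0 < ε := by
    rw [hε]; unfold imagTimeWeight
    have : (0 : ℝ) < M := by
      have hM : 0 < 2 * M := ω.pos
      exact_mod_cast Nat.pos_of_mul_pos_left hM
    positivity
  have hεP : ε * P = β * (L : ℝ) ^ 2 := imagTimeWeight_mul_card β L M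
  have hB0 : 0 ≤ B := by
    refine le_trans ?_ (hB (ω, k₁))
    exact mul_nonneg hεpos.le (sum_nonneg fun y _ => mul_nonneg
      ((isLabelDist_torusSiteDist (d := 2) (L := L)).nonneg _ _) (norm_nonneg _))
  -- the phase of a tuple and the spatial difference
  set e : (Fin 2 → SpaceTimeIdx L M) → ℂ := fun x =>
    Complex.exp (((matsubaraFreq β M ω * (imagTime β M (x 0).1 - imagTime β M (x 1).1) : ℝ) : ℂ) * Complex.I) with he
  have he1 : ∀ x, ‖e x‖ = 1 := fun x => by rw [he]; exact Complex.norm_exp_ofReal_mul_I _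
  -- Fourier representation of the self-energy of `G'` at `(ω, k)`
  have hrep : ∀ k : TorusSite 2 L, selfEnergy L M β G' (ω, k) σ =
      ((2 * (β * (L : ℝ) ^ 2) / P ^ 2 : ℝ) : ℂ) * ∑ x : Fin 2 → SpaceTimeIdx L M, W x * (e x * torusChar k ((x 0).2 - (x 1).2)) := by
    intro k
    have hker := card_sq_mul_kernel_two_eq_sum (hβ.ne') G' (ω, k) σ
    have hP0 : (P : ℂ) ≠ 0 := by exact_mod_cast hPpos.ne'
    have hk : kernel ℂ G' 2 ![(((ω, k), σ), 0), (((ω, k), σ), 1)] =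
        (∑ x : Fin 2 → SpaceTimeIdx L M, W x * (e x * torusChar k ((x 0).2 - (x 1).2))) / (P : ℂ) ^ 2 := by
      rw [eq_div_iff (pow_ne_zero 2 hP0), mul_comm, hP]
      push_cast
      rw [hker]
      refine sum_congr rfl fun x _ => ?_
      rw [hW, conj_phase_eq_cexp_mul_torusChar]
    rw [selfEnergy, vertexFn, hk]
    simp only [Nat.factorial, Nat.succ_eq_add_one, Nat.reduceAdd, zero_add, mul_one, Nat.cast_ofNat]
    push_cast
    field_simp
  -- the difference
  have hdiff : selfEnergy L M β G' (ω, k₁) σ - selfEnergy L M β G' (ω, k₂) σ =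
      ((2 * (β * (L : ℝ) ^ 2) / P ^ 2 : ℝ) : ℂ) *
        ∑ x : Fin 2 → SpaceTimeIdx L M, W x * e x * (torusChar k₁ ((x 0).2 - (x 1).2) - torusChar k₂ ((x 0).2 - (x 1).2)) := by
    rw [hrep k₁, hrep k₂, ← mul_sub, ← sum_sub_distrib]
    congr 1
    refine sum_congr rfl fun x _ => ?_
    ring
  -- the spatial first moment over all tuples
  have htot : ∑ x : Fin 2 → SpaceTimeIdx L M, torusSiteDist (x 0).2 (x 1).2 * ‖W x‖ ≤ P * (B / ε) := by
    set g : SpaceTimeIdx L M → SpaceTimeIdx L M → ℝ := fun a b =>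
      torusSiteDist a.2 b.2 * ‖klTwoLegPosKernel L M β U μ K e₀ n σ a b‖ with hg
    have hfun : ∀ x : Fin 2 → SpaceTimeIdx L M, torusSiteDist (x 0).2 (x 1).2 * ‖W x‖ = g (x 0) (x 1) := by
      intro x
      have hx : x = ![x 0, x 1] := by funext i; fin_cases i <;> rfl
      simp only [hg, klTwoLegPosKernel, ← hG', ← hW]
      rw [← hx]
    have hsum : ∑ x : Fin 2 → SpaceTimeIdx L M, torusSiteDist (x 0).2 (x 1).2 * ‖W x‖ = ∑ a, ∑ b, g a b := by
      rw [← sum_fin_two_tuple g]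
      exact sum_congr rfl fun x _ => hfun x
    rw [hsum]
    have hPsum : P * (B / ε) = ∑ _a : SpaceTimeIdx L M, B / ε := by
      rw [sum_const, card_univ, nsmul_eq_mul, hP]
    rw [hPsum]
    refine sum_le_sum fun a _ => ?_
    rw [le_div_iff₀ hεpos, mul_comm]
    exact hB a
  -- assemble
  have hc0 : 0 ≤ 2 * (β * (L : ℝ) ^ 2) / P ^ 2 := by positivity
  calc ‖selfEnergy L M β G' (ω, k₁) σ - selfEnergy L M β G' (ω, k₂) σ‖
      = ‖((2 * (β * (L : ℝ) ^ 2) / P ^ 2 : ℝ) : ℂ)‖ *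
          ‖∑ x : Fin 2 → SpaceTimeIdx L M, W x * e x * (torusChar k₁ ((x 0).2 - (x 1).2) - torusChar k₂ ((x 0).2 - (x 1).2))‖ := by
        rw [hdiff, norm_mul]
    _ ≤ (2 * (β * (L : ℝ) ^ 2) / P ^ 2) *
          ∑ x : Fin 2 → SpaceTimeIdx L M, torusSiteDist (x 0).2 (x 1).2 * ‖W x‖ * T := by
        rw [Complex.norm_real, Real.norm_of_nonneg hc0]
        refine mul_le_mul_of_nonneg_left ((norm_sum_le _ _).trans (sum_le_sum fun x _ => ?_)) hc0
        rw [norm_mul, norm_mul, he1, mul_one]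
        calc ‖W x‖ * ‖torusChar k₁ ((x 0).2 - (x 1).2) - torusChar k₂ ((x 0).2 - (x 1).2)‖
            ≤ ‖W x‖ * (torusSiteDist (x 0).2 (x 1).2 * T) :=
              mul_le_mul_of_nonneg_left (norm_torusChar_sub_torusChar_le_torusSiteDist k₁ k₂ (x 0).2 (x 1).2) (norm_nonneg _)
          _ = torusSiteDist (x 0).2 (x 1).2 * ‖W x‖ * T := by ring
    _ = (2 * (β * (L : ℝ) ^ 2) / P ^ 2) * (∑ x : Fin 2 → SpaceTimeIdx L M, torusSiteDist (x 0).2 (x 1).2 * ‖W x‖) * T := by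
        rw [← sum_mul, mul_assoc]
    _ ≤ (2 * (β * (L : ℝ) ^ 2) / P ^ 2) * (P * (B / ε)) * T := by gcongr
    _ = 2 * B * T := by
        rw [← hεP]
        field_simp

/-- **(E3-M) at the last scale gives the momentum modulus of the separated self-energy there** (every spin, every Matsubara label;
`β ≥ 0` only through the weight's monotonicity, `β > 0` for the inversion). -/
theorem TwoLegKernelMoments.norm_selfEnergy_sep_sub_le [NeZero M] {G : GeoConsts} {P : SplitConsts} {Q : EngConsts} {β U μ : ℝ}
    {K : TrigPolyC4v} {n : ℕ} (h : TwoLegKernelMoments L M G P Q β U μ K n) (hβ : 0 < β) (σ : Fin 2) (ω : MatsubaraIdx M)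
    (k₁ k₂ : TorusSite 2 L) :
    ‖selfEnergy L M β (klSepAction L M β U μ K klE0 n) (ω, k₁) σ - selfEnergy L M β (klSepAction L M β U μ K klE0 n) (ω, k₂) σ‖ ≤
      2 * twoLegMomentBar P Q U n * ∑ i, torusAbs (latticeMomentum L k₁ i - latticeMomentum L k₂ i) :=
  KLRegimeSplit.norm_selfEnergy_sep_sub_le hβ U μ K klE0 n σ ω k₁ k₂ (fun x => h.site hβ.le σ x)

omit [NeZero L] in
/-- **The frame part is Lipschitz modulo `2π`**: `|K(p_{k₁}) − K(p_{k₂})| ≤ 2·coeffNorm 1 K · Σ_i |p_{k₁} i − p_{k₂} i|_𝕋`. -/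
theorem abs_eval_latticeMomentum_sub_le (K : TrigPolyC4v) (k₁ k₂ : TorusSite 2 L) :
    |K.eval (latticeMomentum L k₁) - K.eval (latticeMomentum L k₂)| ≤
      2 * K.coeffNorm 1 * ∑ i, torusAbs (latticeMomentum L k₁ i - latticeMomentum L k₂ i) := by
  have hK : 0 ≤ 2 * K.coeffNorm 1 := by have := TrigPolyC4v.coeffNorm_nonneg 1 K; positivity
  have hlip : ∀ p q : Fin 2 → ℝ, ‖K.eval p - K.eval q‖ ≤ 2 * K.coeffNorm 1 * ‖p - q‖ := by
    intro p q
    rw [Real.norm_eq_abs]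
    refine (abs_eval_sub_eval_le K p q).trans ?_
    have h0 : |p 0 - q 0| ≤ ‖p - q‖ := by rw [← Real.norm_eq_abs]; exact norm_le_pi_norm (p - q) 0
    have h1 : |p 1 - q 1| ≤ ‖p - q‖ := by rw [← Real.norm_eq_abs]; exact norm_le_pi_norm (p - q) 1
    nlinarith [TrigPolyC4v.coeffNorm_nonneg 1 K]
  have h := norm_sub_le_mul_tmod_of_periodic (E := ℝ) (f := fun p : Fin 2 → ℝ => K.eval p) hK
    (fun p m => TrigPolyC4v.eval_periodic K p m) hlip (latticeMomentum L k₁) (latticeMomentum L k₂)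
  rw [Real.norm_eq_abs] at h
  exact h

end PerVolume

/-! ## The corollary -/

/-- **THE COROLLARY HOLDS**: (E3-M) along the tower ⇒ the framed momentum modulus (M) of the VL carrier export, with
`D := 2·twoLegMomentBar P Q U (nScales β + 1) + 2·coeffNorm 1 K`, `ρ′ := 0`, thresholds those of the moments text. -/
theorem carrierModulusOfTwoLegMoments_holds (Pr : Preds) (W : Set ℝ) : CarrierModulusOfTwoLegMoments Pr W := by
  intro hmom G P Q R hG hP hQ hR
  obtain ⟨c₅, hc₅, h₁⟩ := hmom G P Q R hG hP hQ hR
  refine ⟨c₅, hc₅, fun c hc hcle => ?_⟩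
  obtain ⟨U₀, hU₀, h₂⟩ := h₁ c hc hcle
  refine ⟨U₀, hU₀, fun μ hμ U hU hUle β hβmin hβle K hK Lstar Mstar hT => ?_⟩
  obtain ⟨L₁, M₁, hLM⟩ := h₂ μ hμ U hU hUle β hβmin hβle K hK Lstar Mstar hT
  have hβ : 0 < β := pos_of_klBetaMin_le hβmin
  refine ⟨L₁, 2 * twoLegMomentBar P Q U (nScales β + 1) + 2 * K.coeffNorm 1, fun _ => 0, tendsto_const_nhds,
    fun L _ hL => ⟨M₁ L, fun M _ hM ω k₁ k₂ => ?_⟩⟩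
  have hN : TwoLegKernelMoments L M G P Q β U μ K (nScales β + 1) := hLM L hL M hM (nScales β + 1) le_rfl
  set T : ℝ := ∑ i, torusAbs (latticeMomentum L k₁ i - latticeMomentum L k₂ i) with hT
  rw [klSelfEnergy_eq_sep_add_counter, klSelfEnergy_eq_sep_add_counter, selfEnergy_counterQuadratic hβ.ne',
    selfEnergy_counterQuadratic hβ.ne', zero_add]
  have hsep := hN.norm_selfEnergy_sep_sub_le hβ 0 ω k₁ k₂
  have hfr := abs_eval_latticeMomentum_sub_le (L := L) K k₁ k₂
  calc ‖selfEnergy L M β (klSepAction L M β U μ K klE0 (nScales β + 1)) (ω, k₁) 0 + ((K.eval (latticeMomentum L k₁) : ℝ) : ℂ) -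
        (selfEnergy L M β (klSepAction L M β U μ K klE0 (nScales β + 1)) (ω, k₂) 0 + ((K.eval (latticeMomentum L k₂) : ℝ) : ℂ))‖
      = ‖(selfEnergy L M β (klSepAction L M β U μ K klE0 (nScales β + 1)) (ω, k₁) 0 -
          selfEnergy L M β (klSepAction L M β U μ K klE0 (nScales β + 1)) (ω, k₂) 0) +
          (((K.eval (latticeMomentum L k₁) : ℝ) : ℂ) - ((K.eval (latticeMomentum L k₂) : ℝ) : ℂ))‖ := by ring_nf
    _ ≤ ‖selfEnergy L M β (klSepAction L M β U μ K klE0 (nScales β + 1)) (ω, k₁) 0 -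
          selfEnergy L M β (klSepAction L M β U μ K klE0 (nScales β + 1)) (ω, k₂) 0‖ +
          ‖((K.eval (latticeMomentum L k₁) : ℝ) : ℂ) - ((K.eval (latticeMomentum L k₂) : ℝ) : ℂ)‖ := norm_add_le _ _
    _ ≤ 2 * twoLegMomentBar P Q U (nScales β + 1) * T + 2 * K.coeffNorm 1 * T := by
        refine add_le_add hsep ?_
        rw [← Complex.ofReal_sub, Complex.norm_real, Real.norm_eq_abs]
        exact hfr
    _ = (2 * twoLegMomentBar P Q U (nScales β + 1) + 2 * K.coeffNorm 1) * T := by ring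

end Summit.HubbardSuperconductivity.HubbardSuperconductivity.Theorems.KLRegimeSplit

end
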